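import Mathlib
import Literature.Computability.AlgebraicComplexity.PrattTrapezoidVal
import Literature.Computability.AlgebraicComplexity.PrattTrapezoidValBounds
import Summits.MatrixMultiplication.MatrixMultiplication.Theorems.SoloBlindPrattValEventually

/-!
# Solo-blind seat, s42 (fourth file): an explicit rate — `Val(ℤ/nℤ) ≥ n · exp(c √(log n))`

`SoloBlindPrattValEventually` proves `Val(ℤ/nℤ)/n → ∞` without a rate (its tower of prime
blocks uses Euclid's theorem).  Replacing Euclid by Bertrand's postulate (Mathlib:
`Nat.exists_prime_lt_and_le_two_mul`) and taking the three primes of the `t`-th block from the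
consecutive dyadic intervals `(2^{3t+4}, 2^{3t+5}]`, `(2^{3t+5}, 2^{3t+6}]`, `(2^{3t+6}, 2^{3t+7}]`
(automatically distinct, `≥ 17`, and coprime to the earlier blocks, whose prime factors are
`≤ 2^{3t+4}`), the `t`-block modulus `K_t` satisfies `K_t ≤ 2^{9t² + 18t}` and
`5^t K_t ≤ 4^t Val(ℤ/K_t)` (`soloVal_tower_explicit`).  The lift of `SoloBlindPrattValEventually`
(`soloVal_prattVal_zmod_eventually_aux`: one block modulus `K` serves every `n ≥ 6K² + 6K` at the
cost of a factor `24`) then gives the explicit statement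

  `soloVal_prattVal_zmod_rate : 2^{18t² + 36t + 4} ≤ n → 5^t (n+1) ≤ 4^t · 12 · (2 Val(ℤ/(n+1)) + 1)`,

i.e. `Val(ℤ/nℤ) ≥ (5/4)^t · n/24 − 1/2` as soon as `n > 2^{18t²+36t+4}`; with
`t = ⌊√(log₂ n / 18)⌋ − 2` this is `Val(ℤ/nℤ) ≥ n · exp(c √(log n))` for an absolute `c > 0` and all
large `n`.  (The pen rate in SHARPEST §3 Q12, `n · exp(((2/3) ln 2 − o(1)) ln n / ln ln n)`, needs
Chebyshev-type prime counting and the CKSU capacity `N_{3j} ≥ 2^j`; this file certifies the weaker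
but fully explicit `exp(c√log n)` with the two-row puzzle only.)

References: [Pratt2024] K. Pratt, arXiv:2309.03878, Def. 3.2, Prop. 3.5, Conj. 4.1.
-/

set_option linter.dupNamespace false

namespace Summit.MatrixMultiplication.MatrixMultiplication.Theorems

open Finset Literature.Computability.AlgebraicComplexity

/-- **Explicit tower.** For every `t` there is a modulus `K = n + 1 ≤ 2^{9t²+18t}`, all of whose
prime factors are `≤ 2^{3t+4}`, with `5^t K ≤ 4^t Val(ℤ/Kℤ)` (blocks of three Bertrand primes from
consecutive dyadic intervals, glued by Pratt's super-multiplicativity `prattVal_zmod_mul_le`). -/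
theorem soloVal_tower_explicit (t : ℕ) :
    ∃ n : ℕ, n + 1 ≤ 2 ^ (9 * t * t + 18 * t) ∧
      (∀ s : ℕ, s.Prime → s ∣ n + 1 → s ≤ 2 ^ (3 * t + 4)) ∧
      5 ^ t * (n + 1) ≤ 4 ^ t * prattVal (ZMod (n + 1)) := by
  induction t with
  | zero =>
    refine ⟨0, by norm_num, ?_, ?_⟩
    · intro s hs hdvd
      have h1 : s ≤ 1 := Nat.le_of_dvd Nat.one_pos hdvd
      exact absurd hs (by interval_cases s <;> decide)
    · have h := card_le_prattVal (G := ZMod 1)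
      rw [ZMod.card] at h
      simpa using h
  | succ t ih =>
    obtain ⟨n, hnle, hfac, hn⟩ := ih
    -- name the dyadic scale `P = 2^{3t+4} ≥ 16`
    obtain ⟨P, hP⟩ : ∃ P, 2 ^ (3 * t + 4) = P := ⟨_, rfl⟩
    have hP16 : 16 ≤ P := by
      rw [← hP]
      calc 16 = 2 ^ 4 := by norm_num
        _ ≤ 2 ^ (3 * t + 4) := Nat.pow_le_pow_right (by norm_num) (by omega)
    have hP5 : 2 ^ (3 * t + 5) = 2 * P := by rw [← hP]; ring
    have hP6 : 2 ^ (3 * t + 6) = 2 * (2 * P) := by rw [← hP]; ring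
    have hP7 : 2 ^ (3 * (t + 1) + 4) = 2 * (2 * (2 * P)) := by rw [← hP]; ring
    -- three Bertrand primes `P < p ≤ 2P < q ≤ 4P < r ≤ 8P`
    obtain ⟨p, hp, hp1, hp2⟩ := Nat.exists_prime_lt_and_le_two_mul P (by omega)
    obtain ⟨q, hq, hq1, hq2⟩ := Nat.exists_prime_lt_and_le_two_mul (2 * P) (by omega)
    obtain ⟨r, hr, hr1, hr2⟩ := Nat.exists_prime_lt_and_le_two_mul (2 * (2 * P)) (by omega)
    have hpq : p ≠ q := by omega
    have hqr : q ≠ r := by omega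
    have hpr : p ≠ r := by omega
    -- coprimality of `n + 1` (prime factors `≤ P`) with the three fresh primes (`> P`)
    have hcop : ∀ s : ℕ, s.Prime → P < s → Nat.Coprime (n + 1) s := by
      intro s hs hlt
      rw [Nat.coprime_comm, Nat.Prime.coprime_iff_not_dvd hs]
      intro hdvd
      exact absurd (hfac s hs hdvd) (by omega)
    have hc : Nat.Coprime (n + 1) (p * q * r) :=
      Nat.Coprime.mul_right (Nat.Coprime.mul_right (hcop p hp (by omega)) (hcop q hq (by omega)))
        (hcop r hr (by omega))
    have hpos : 0 < p * q * r := Nat.mul_pos (Nat.mul_pos hp.pos hq.pos) hr.pos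
    haveI : NeZero (p * q * r) := ⟨hpos.ne'⟩
    have hblock := soloVal_primeBlock p q r hp hq hr hpq hqr hpr (by omega) (by omega) (by omega)
    have hmul := prattVal_zmod_mul_le (m := n + 1) (n := p * q * r) hc
    -- the new modulus, written as a successor
    refine ⟨(n + 1) * (p * q * r) - 1, ?_⟩
    have hN : (n + 1) * (p * q * r) - 1 + 1 = (n + 1) * (p * q * r) := by
      have : 1 ≤ (n + 1) * (p * q * r) := Nat.mul_pos (Nat.succ_pos n) hpos
      omega
    have hcongr : prattVal (ZMod ((n + 1) * (p * q * r) - 1 + 1)) =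
        prattVal (ZMod ((n + 1) * (p * q * r))) :=
      prattVal_congr (ZMod.ringEquivCongr hN).toAddEquiv
    rw [hcongr, hN]
    refine ⟨?_, ?_, ?_⟩
    · -- size: `(n+1) p q r ≤ 2^{9t²+18t} · 2P · 4P · 8P = 2^{9t²+27t+18} ≤ 2^{9(t+1)²+18(t+1)}`
      have hpqr : p * q * r ≤ 2 * P * (2 * (2 * P)) * (2 * (2 * (2 * P))) :=
        Nat.mul_le_mul (Nat.mul_le_mul hp2 hq2) hr2
      have h64 : 2 * P * (2 * (2 * P)) * (2 * (2 * (2 * P))) = 2 ^ (9 * t + 18) := by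
        rw [← hP]; ring
      calc (n + 1) * (p * q * r)
          ≤ 2 ^ (9 * t * t + 18 * t) * 2 ^ (9 * t + 18) := by
            rw [← h64]; exact Nat.mul_le_mul hnle hpqr
        _ = 2 ^ (9 * t * t + 18 * t + (9 * t + 18)) := by rw [← pow_add]
        _ ≤ 2 ^ (9 * (t + 1) * (t + 1) + 18 * (t + 1)) :=
            Nat.pow_le_pow_right (by norm_num) (by ring_nf; omega)
    · -- prime factors of the new modulus are `≤ 8P = 2^{3(t+1)+4}`
      intro s hs hdvd
      rw [hP7]
      rcases (Nat.Prime.dvd_mul hs).1 hdvd with h1 | h1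
      · exact (hfac s hs h1).trans (by omega)
      · rcases (Nat.Prime.dvd_mul hs).1 h1 with h2 | h2
        · rcases (Nat.Prime.dvd_mul hs).1 h2 with h3 | h3
          · rw [(Nat.prime_dvd_prime_iff_eq hs hp).1 h3]; omega
          · rw [(Nat.prime_dvd_prime_iff_eq hs hq).1 h3]; omega
        · rw [(Nat.prime_dvd_prime_iff_eq hs hr).1 h2]; omega
    · -- value: `5^{t+1} (n+1) pqr ≤ 4^t V(n+1) · 4 V(pqr) ≤ 4^{t+1} V((n+1) pqr)`
      have hprod := Nat.mul_le_mul hn hblock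
      calc 5 ^ (t + 1) * ((n + 1) * (p * q * r))
          = 5 ^ t * (n + 1) * (5 * (p * q * r)) := by ring
        _ ≤ 4 ^ t * prattVal (ZMod (n + 1)) * (4 * prattVal (ZMod (p * q * r))) := hprod
        _ = 4 ^ (t + 1) * (prattVal (ZMod (n + 1)) * prattVal (ZMod (p * q * r))) := by ring
        _ ≤ 4 ^ (t + 1) * prattVal (ZMod ((n + 1) * (p * q * r))) :=
            Nat.mul_le_mul_left _ hmul

/-- **Explicit rate for Pratt's `Val(ℤ/nℤ)`.**  For all `t` and all `n ≥ 2^{18t²+36t+4}`: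
`5^t (n+1) ≤ 4^t · 12 · (2·Val(ℤ/(n+1)ℤ) + 1)`, i.e. `Val(ℤ/Nℤ) ≥ (5/4)^t N/24 − 1/2` for every
`N > 2^{18t²+36t+4}`; choosing `t ≍ √(log N)` gives `Val(ℤ/Nℤ) ≥ N · exp(c √(log N))` for an absolute
constant `c > 0` and all large `N`. -/
theorem soloVal_prattVal_zmod_rate (t n : ℕ) (hn : 2 ^ (18 * t * t + 36 * t + 4) ≤ n) :
    5 ^ t * (n + 1) ≤ 4 ^ t * (12 * (2 * prattVal (ZMod (n + 1)) + 1)) := by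
  obtain ⟨m, hmle, -, hm⟩ := soloVal_tower_explicit t
  refine soloVal_prattVal_zmod_eventually_aux (K := m + 1) hm n ?_
  -- `6(m+1)² + 6(m+1) ≤ 12 (m+1)² ≤ 16 · (2^{9t²+18t})² = 2^{18t²+36t+4} ≤ n`
  obtain ⟨Q, hQ⟩ : ∃ Q, 2 ^ (9 * t * t + 18 * t) = Q := ⟨_, rfl⟩
  rw [hQ] at hmle
  have hQQ : 2 ^ (18 * t * t + 36 * t + 4) = 16 * (Q * Q) := by rw [← hQ]; ring
  rw [hQQ] at hn
  have h1 : (m + 1) * (m + 1) ≤ Q * Q := Nat.mul_le_mul hmle hmle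
  have h2 : 6 * (m + 1) * (m + 1) + 6 * (m + 1) ≤ 12 * ((m + 1) * (m + 1)) := by
    have h3 : m + 1 ≤ (m + 1) * (m + 1) := Nat.le_mul_of_pos_right _ (Nat.succ_pos m)
    calc 6 * (m + 1) * (m + 1) + 6 * (m + 1)
        = 6 * ((m + 1) * (m + 1)) + 6 * (m + 1) := by ring
      _ ≤ 6 * ((m + 1) * (m + 1)) + 6 * ((m + 1) * (m + 1)) := by omega
      _ = 12 * ((m + 1) * (m + 1)) := by ring
  calc 6 * (m + 1) * (m + 1) + 6 * (m + 1) ≤ 12 * ((m + 1) * (m + 1)) := h2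
    _ ≤ 12 * (Q * Q) := Nat.mul_le_mul_left _ h1
    _ ≤ 16 * (Q * Q) := Nat.mul_le_mul_right _ (by norm_num)
    _ ≤ n := hn

end Summit.MatrixMultiplication.MatrixMultiplication.Theorems
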